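import Summits.HodgeConjecture.HodgeConjecture.Theorems.SignSymmetricPowersOrbitDataPoint
import Summits.HodgeConjecture.HodgeConjecture.Theorems.SignSymmetricPowersFourFactsMono
import Summits.HodgeConjecture.HodgeConjecture.Theorems.SignSymmetricPowersClose
import Summits.HodgeConjecture.HodgeConjecture.Theorems.SmoothHypersurfaceGeometricGenus
import Literature.AlgebraicGeometry.HodgeTheory.SignSymmetricOneSeedHodgeGroup
import Literature.AlgebraicGeometry.HodgeTheory.AlgebraicMonodromyMumfordTateOfQuasiProjective
import Literature.AlgebraicGeometry.HodgeTheory.TensorStabilizerZariskiClosed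
import HarnessLib

/-!
# Route SignSymmetricPowers — the PER-POINT KERNEL of K1-B: sign commutators in the Hodge group, and HC on all powers, for every
# ι-even threefold whose classifying point has LARGE MUMFORD–TATE GROUP (CDK-free; the entry of reading (a″)-B «PENCIL-B»)

Support file for `stmt-HodgeConjecture-19716` (`--supports`, helper; nothing here closes an item).  Prover seat `hodge-nonav-19716-p2`
(g11, registry keeper of K1-B), cell `hodge-nonav`.  Route-B twin of route A's `CyclicUnitaryPowersFiniteIndexMonodromyDeckCommutators`
(PENCIL-1): the kernel of `SignSymmetricPowersFourFactsMono.veryGeneralSignCommutatorsInHg_of_signDeckHodge_mono` from the line `hΓ` on,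
VERBATIM, with the Cattani–Deligne–Kaplan cover REMOVED — its only use there was to produce, for very general `f`, the inclusion
`Mon⁰ ⊆ MT` at the classifying point; here that inclusion is the HYPOTHESIS, at ONE point, in the three shapes a consumer meets:

* `signComm_of_identityComponent_le` — `(Γ^Zar)⁰ ⊆ MT(H³(𝒴_t))` (`glIdentityComponent`, the MODEL-FREE Hodge structure `hodge _ _ 3`)
  ⟹ every commutator of two `σ_f`-commuting cup-isometries of `H³(X_f; ℚ)` lies in `Hg(H³(X_f))`; `t = classifyingPoint ℂ 3 d M_ι t₀ f`,
  `Γ = ratMonodromyGroup (familyM ℂ 3 d M_ι) 3 hU ⟨t, _⟩` (envelope `signPencilEnvelope_point` + Theorem A's algebra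
  `commutator_mem_hodgeGroup_of_signSymmetric_of_eigenCentres`);
* `signComm_of_finiteIndex_le_mumfordTate` — the same from a finite-index subgroup `Γ' ≤ Γ` inside `MT` read in ANY Hodge-symmetric
  models `A` (what Zariski's theorem + base change of monodromy deliver on a pencil; `glIdentityComponent_subset_of_finiteIndex`,
  `glZariskiClosure_subset_mumfordTateGroup`, `HodgeModel.hodgeStructure_eq_hodge`);
* `signComm_of_isHodgeGenericPoint` — the same at a HODGE-GENERIC classifying point (Deligne's lemma, tree theorem
  `deligne_finiteIndex_monodromy_le_mumfordTateGroup_of_isQuasiProjectiveOver`, CMSP 15.3.7 (ii));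
* `exists_signDeck_comm_of_identityComponent_le`, **`hodgeConjectureFor_signPowers_of_identityComponent_le`** (+ `_of_finiteIndex_le_mumfordTate`,
  `_of_isHodgeGenericPoint`) — for every smooth projective `X` cut out in `ℙ⁴` by `f`: the route's `Deck ∧ Comm` package (deck Hodge numbers
  from `signDeckHodge_of_genusBound stub_genusBoundThreefold`, model transfer as in `stub_modelTransfer`) and `HodgeConjectureFor (3(k+1)) Y`
  for every self fibre power `Y` (K2-B `SignSymmetricPowersClose.powersHodgeOfSignCommutators`, closed item 19717).

hN′ (`stub_a3NonCommOdd`) is an explicit hypothesis `hNC` (to be deleted by a twin once the A₃ port lands).  CONDITIONAL on hN′; CDK-FREE;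
HC ∕ HC_AV not proved; rung F-H1 not moved.

## References
* [CarlsonMullerStachPeters2017] J. Carlson, S. Müller-Stach, C. Peters, Period Mappings and Period Domains, 2nd ed., Lemma–Def. 15.3.7, Thm. 15.2.9.
* [Deligne1972WeilK3] P. Deligne, La conjecture de Weil pour les surfaces K3, Invent. Math. 15 (1972), Prop. 7.5.
* [VoisinHodgeII2003] C. Voisin, Hodge Theory and Complex Algebraic Geometry II, §3.2 (Picard–Lefschetz), §6.1.3 Cor. 6.12.
* [Arapura2012] D. Arapura, Algebraic Geometry over the Complex Numbers, §17.3 (17.3.1).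
-/

noncomputable section

set_option linter.dupNamespace false
set_option maxHeartbeats 800000

namespace Summit.HodgeConjecture.HodgeConjecture.Theorems.SignSymmetricPowersFiniteIndexMonodromySignCommutators

open MvPolynomial CategoryTheory CategoryTheory.Limits
open Literature.AlgebraicGeometry.Motives Literature.AlgebraicGeometry.HodgeTheory
open Literature.AlgebraicGeometry.HodgeTheory.BettiUniverse
open Literature.AlgebraicTopology.SingularHomology
open Literature.AlgebraicGeometry.FundamentalGroup (affineHypersurfaceComplement_meridians_normalClosure_eq_top_holds
  affineHypersurfaceComplement_meridian_isConj_holds)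
open Summit.HodgeConjecture.HodgeConjecture.Theorems.SignSymmetricPowersFourFactsGeometricGenus (signDeckHodge_of_genusBound)
open Summit.HodgeConjecture.HodgeConjecture.Theorems.SignSymmetricPowersOrbitDataPoint (signPencilEnvelope_point)

/-! ### §1 Sign commutators in the Hodge group from `Mon⁰ ⊆ MT` at the classifying point -/

open Literature.AlgebraicGeometry.Motives Literature.AlgebraicGeometry.Motives.UniversalHypersurface Literature.AlgebraicGeometry.HodgeTheory Literature.AlgebraicGeometry.HodgeTheory.UniversalHypersurface Literature.AlgebraicGeometry.HodgeTheory.BettiUniverse CategoryTheory.Limits in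
/-- **Sign commutators in the Hodge group from `(Γ^Zar)⁰ ⊆ MT` at the classifying point** (the kernel of
`veryGeneralSignCommutatorsInHg_of_signDeckHodge_mono` from `hΓ` on, verbatim; CDK-free).  For even `d ≥ 4`, a nonsingular ι-even quinary
`f` of degree `d`, and the monodromy group `Γ` of `familyM ℂ 3 d M_ι` at `t = classifyingPoint ℂ 3 d M_ι t₀ f`: if
`glIdentityComponent Γ ⊆ MT(hodge _ (fibre at t) 3)` then every commutator of two `σ_f`-commuting `tr ∘ cup`-isometries of
`H³(X_f; ℚ)` lies in `Hg(hodge _ X_f 3)`.  CONDITIONAL on hN′ (`hNC`). [cite: CarlsonMullerStachPeters2017, Lemma–Definition 15.3.7]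
[cite: VoisinHodgeII2003, §6.1.3 Cor. 6.12] -/
theorem signComm_of_identityComponent_le
    (hNC : ∀ (n d : ℕ) (f₁ g₀ g₂ : MvPolynomial (Fin (n + 2)) ℂ) (j k : Fin (n + 2)) (a : Fin (n + 2) → ℂˣ),
      1 ≤ n → 1 ≤ d → Odd n → (∃ (i : Fin (n + 2)) (c : ℂ), g₀ = c • MvPolynomial.X i ^ d) →
      f₁.IsHomogeneous d → g₀.IsHomogeneous d → g₂.IsHomogeneous d → Literature.AlgebraicGeometry.HodgeTheory.IsSymmetricA3Datum f₁ g₀ g₂ j k a →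
      ∀ (εa εb : ℝ) (ψ : ℂ → ℂ), Literature.AlgebraicGeometry.HodgeTheory.IsSymmetricA3Bifurcation f₁ g₀ g₂ j a εa εb ψ →
        ∃ εa' : ℝ, 0 < εa' ∧ εa' ≤ εa ∧ Literature.AlgebraicGeometry.HodgeTheory.SymmetricA3NonCommutation n d f₁ g₀ g₂ ψ εa') :
    ∀ ⦃d : ℕ⦄, Even d → ∀ (h4d : 4 ≤ d), (let M : Set (DegIndex 3 d) := {m | Even (m.1 0 + m.1 1)}; let γ : Fin 5 → ℂˣ := fun i => if (i : ℕ) < 2 then -1 else 1; let u := familyM ℂ 3 d M; let hu : IsSmoothProjectiveFamily u 3 := isSmoothProjectiveFamily_familyM ℂ 3 d M (by decide) (le_trans (by decide) h4d); let hU : IsCohomologicallyLocallyTrivialOn u (Set.univ : Set (ComplexPoints (baseM ℂ 3 d M))) := isCohomologicallyLocallyTrivialOn_familyM 3 d M (by decide) (le_trans (by decide) h4d); ∀ (t₀ : ComplexPoints (baseM ℂ 3 d M)) (f : MvPolynomial (Fin 5) ℂ), f.IsHomogeneous d → (∀ e : Fin 5 →₀ ℕ, ¬ Even (e 0 + e 1)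 → f.coeff e = 0) → SmoothHypersurface.IsNonsingularForm ℂ f → ∀ (hXF : IsSmoothProjective 3 (SmoothHypersurface.hypersurface f)) (ha : γ ∈ diagonalStabilizer f), let t := classifyingPoint ℂ 3 d M t₀ f; let hY : IsSmoothProjective 3 (fiberOver u t) := hu.isSmoothProjective t; (haveI : HodgeTensorFacts.{0, 0} := hodgeTensorFacts_holds; haveI := finite hY 3; glIdentityComponent (ratMonodromyGroup u 3 hU ⟨t, Set.mem_univ _⟩) ⊆ ((hodge exists_isReal_hodgeModel_holds hY 3).mumfordTateGroup : Set (bettiCohomology (fiberOver u t) 3 ≃ₗ[ℚ] bettiCohomology (fiberOver u t) 3))) → (haveI : HodgeTensorFacts.{0, 0} := hodgeTensorFacts_holds; haveI := finite hXF 3; ∀ g h : bettiCohomology (SmoothHypersurface.hypersurface f) 3 ≃ₗ[ℚ] bettiCohomology (SmoothHypersurface.hypersurface f) 3, ((∀ x, g (pull (diagonalAut f ha) 3 x) = pull (diagonalAut f ha) 3 (g x)) ∧ ∀ x y, tr hXF (3 + 3) (cup (SmoothHypersurface.hypersurface f) 3 3 (g x) (g y)) = tr hXF (3 + 3) (cup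 (SmoothHypersurface.hypersurface f) 3 3 x y)) → ((∀ x, h (pull (diagonalAut f ha) 3 x) = pull (diagonalAut f ha) 3 (h x)) ∧ ∀ x y, tr hXF (3 + 3) (cup (SmoothHypersurface.hypersurface f) 3 3 (h x) (h y)) = tr hXF (3 + 3) (cup (SmoothHypersurface.hypersurface f) 3 3 x y)) → g * h * g⁻¹ * h⁻¹ ∈ (hodge exists_isReal_hodgeModel_holds hXF 3).hodgeGroup)) := by
  intro d hd h4d M γ u hu hU t₀ f hf hev hJ hXF ha t hY hΓ
  haveI hHTF : HodgeTensorFacts.{0, 0} := hodgeTensorFacts_holds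
  intro g h hg hh
  obtain ⟨φ, B, hB, hBn, τ, hτ, T, D, hNon, hτB, hφτ, hφB, hHG, hT, hD, hTsign, hseed, hspanPos, hconnPos,
    hspanNeg, hconnNeg⟩ := signPencilEnvelope_point affineHypersurfaceComplement_meridians_normalClosure_eq_top_holds
      discriminant_localBranches_nodal_holds hNC affineHypersurfaceComplement_meridian_isConj_holds hd h4d t₀ f hf hev hJ hXF ha
  haveI := finite hXF 3
  haveI := finite hY 3
  haveI : Nontrivial (bettiCohomology (fiberOver u t) 3) := hNon
  -- transport the two σ-centraliser isometries to the fibre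
  have hστ : ∀ y, τ (φ.symm y) = φ.symm (pull (diagonalAut f ha) 3 y) := fun y => by
    apply φ.injective
    rw [hφτ, LinearEquiv.apply_symm_apply, LinearEquiv.apply_symm_apply]
  have cenτ : ∀ k : bettiCohomology (SmoothHypersurface.hypersurface f) 3 ≃ₗ[ℚ] bettiCohomology (SmoothHypersurface.hypersurface f) 3,
      (∀ x, k (pull (diagonalAut f ha) 3 x) = pull (diagonalAut f ha) 3 (k x)) →
      ∀ x, ((φ.trans k).trans φ.symm) (τ x) = τ (((φ.trans k).trans φ.symm) x) := by
    intro k hk x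
    simp only [LinearEquiv.trans_apply]
    rw [hφτ, hk, hστ]
  have cenB : ∀ k : bettiCohomology (SmoothHypersurface.hypersurface f) 3 ≃ₗ[ℚ] bettiCohomology (SmoothHypersurface.hypersurface f) 3,
      (∀ x y, tr hXF (3 + 3) (cup (SmoothHypersurface.hypersurface f) 3 3 (k x) (k y)) = tr hXF (3 + 3) (cup (SmoothHypersurface.hypersurface f) 3 3 x y)) →
      ∀ x y, B (((φ.trans k).trans φ.symm) x) (((φ.trans k).trans φ.symm) y) = B x y := by
    intro k hk x y
    simp only [LinearEquiv.trans_apply]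
    rw [hφB, LinearEquiv.apply_symm_apply, LinearEquiv.apply_symm_apply, hk, ← hφB]
  -- Theorem A's algebra with fixed centres of UNKNOWN sign (W-ELIM kernel): commutators of the sign-symmetric
  -- centraliser of the fibre lie in its Hodge group
  have hpol : (hodge exists_isReal_hodgeModel_holds hY 3).IsPolarizable :=
    smoothProjective_hodgeStructure_isPolarizable_holds hY (realHodgeModel exists_isReal_hodgeModel_holds hY)
      (realHodgeModel_isHodgeSymmetric exists_isReal_hodgeModel_holds hY) 3
  have hcomm := commutator_mem_hodgeGroup_of_signSymmetric_of_eigenCentres (hodge exists_isReal_hodgeModel_holds hY 3) hpol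
    ⟨1, by norm_num⟩ hB hBn hτ hτB hΓ hT hD hTsign hseed hspanPos hconnPos hspanNeg hconnNeg
    (cenτ g hg.1) (cenB g hg.2) (cenτ h hh.1) (cenB h hh.2)
  -- transport back to `H³(X_f;ℚ)` along `φ` (Hodge groups correspond)
  have hback := hHG _ hcomm
  have hid : (φ.symm.trans (((φ.trans g).trans φ.symm) * ((φ.trans h).trans φ.symm) *
      ((φ.trans g).trans φ.symm)⁻¹ * ((φ.trans h).trans φ.symm)⁻¹)).trans φ = g * h * g⁻¹ * h⁻¹ := by
    have hinv : ∀ k : bettiCohomology (SmoothHypersurface.hypersurface f) 3 ≃ₗ[ℚ] bettiCohomology (SmoothHypersurface.hypersurface f) 3,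
        ((φ.trans k).trans φ.symm)⁻¹ = (φ.trans k⁻¹).trans φ.symm := by
      intro k
      rw [inv_eq_iff_mul_eq_one]
      ext x
      simp
    rw [hinv, hinv]
    ext x
    simp
  rw [hid] at hback
  exact hback

open Literature.AlgebraicGeometry.Motives Literature.AlgebraicGeometry.Motives.UniversalHypersurface Literature.AlgebraicGeometry.HodgeTheory Literature.AlgebraicGeometry.HodgeTheory.UniversalHypersurface Literature.AlgebraicGeometry.HodgeTheory.BettiUniverse CategoryTheory.Limits in
/-- **The same from a finite-index subgroup of the monodromy group inside the Mumford–Tate group, read in ANY Hodge-symmetric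
models** (Deligne-(i) shape: what Zariski's theorem on `π₁` of a transversal pencil and the base change of monodromy deliver): the
identity component lies in the Zariski closure of every finite-index subgroup (`glIdentityComponent_subset_of_finiteIndex`), the
Mumford–Tate group is Zariski closed (`glZariskiClosure_subset_mumfordTateGroup`), and the Hodge structure of every Hodge-symmetric model
is THE Hodge structure (`HodgeModel.hodgeStructure_eq_hodge`).  CONDITIONAL on hN′. [cite: CarlsonMullerStachPeters2017, Lemma–Definition 15.3.7 and Theorem 15.2.9] -/
theorem signComm_of_finiteIndex_le_mumfordTate
    (hNC : ∀ (n d : ℕ) (f₁ g₀ g₂ : MvPolynomial (Fin (n + 2)) ℂ) (j k : Fin (n + 2)) (a : Fin (n + 2) → ℂˣ),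
      1 ≤ n → 1 ≤ d → Odd n → (∃ (i : Fin (n + 2)) (c : ℂ), g₀ = c • MvPolynomial.X i ^ d) →
      f₁.IsHomogeneous d → g₀.IsHomogeneous d → g₂.IsHomogeneous d → Literature.AlgebraicGeometry.HodgeTheory.IsSymmetricA3Datum f₁ g₀ g₂ j k a →
      ∀ (εa εb : ℝ) (ψ : ℂ → ℂ), Literature.AlgebraicGeometry.HodgeTheory.IsSymmetricA3Bifurcation f₁ g₀ g₂ j a εa εb ψ →
        ∃ εa' : ℝ, 0 < εa' ∧ εa' ≤ εa ∧ Literature.AlgebraicGeometry.HodgeTheory.SymmetricA3NonCommutation n d f₁ g₀ g₂ ψ εa') :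
    ∀ ⦃d : ℕ⦄, Even d → ∀ (h4d : 4 ≤ d), (let M : Set (DegIndex 3 d) := {m | Even (m.1 0 + m.1 1)}; let γ : Fin 5 → ℂˣ := fun i => if (i : ℕ) < 2 then -1 else 1; let u := familyM ℂ 3 d M; let hu : IsSmoothProjectiveFamily u 3 := isSmoothProjectiveFamily_familyM ℂ 3 d M (by decide) (le_trans (by decide) h4d); let hU : IsCohomologicallyLocallyTrivialOn u (Set.univ : Set (ComplexPoints (baseM ℂ 3 d M))) := isCohomologicallyLocallyTrivialOn_familyM 3 d M (by decide) (le_trans (by decide) h4d); ∀ (A : ∀ s : ComplexPoints (baseM ℂ 3 d M), HodgeModel 3 (fiberOver u s)) (hA : ∀ s, (A s).IsHodgeSymmetric) (t₀ : ComplexPoints (baseM ℂ 3 d M)) (f : MvPolynomial (Fin 5) ℂ), f.IsHomogeneous d → (∀ e : Fin 5 →₀ ℕ, ¬ Even (e 0 + e 1) → f.coeff e = 0) → SmoothHypersurface.IsNonsingularForm ℂ f → ∀ (hXF : IsSmoothProjective 3 (SmoothHypersurface.hypersurface f)) (ha : γ ∈ diagonalStabilizer f), let t := classifyingPoint ℂ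 3 d M t₀ f; let hY : IsSmoothProjective 3 (fiberOver u t) := hu.isSmoothProjective t; (haveI : HodgeTensorFacts.{0, 0} := hodgeTensorFacts_holds; haveI := finite hY 3; ∃ Γ' : Subgroup (bettiCohomology (fiberOver u t) 3 ≃ₗ[ℚ] bettiCohomology (fiberOver u t) 3), Γ' ≤ ratMonodromyGroup u 3 hU ⟨t, Set.mem_univ _⟩ ∧ (Γ'.subgroupOf (ratMonodromyGroup u 3 hU ⟨t, Set.mem_univ _⟩)).FiniteIndex ∧ Γ' ≤ ((A t).hodgeStructure hY (hA t) 3).mumfordTateGroup) → (haveI : HodgeTensorFacts.{0, 0} := hodgeTensorFacts_holds; haveI := finite hXF 3; ∀ g h : bettiCohomology (SmoothHypersurface.hypersurface f) 3 ≃ₗ[ℚ] bettiCohomology (SmoothHypersurface.hypersurface f) 3, ((∀ x, g (pull (diagonalAut f ha) 3 x) = pull (diagonalAut f ha) 3 (g x)) ∧ ∀ x y, tr hXF (3 + 3) (cup (SmoothHypersurface.hypersurface f) 3 3 (g x) (g y)) = tr hXF (3 + 3) (cup (SmoothHypersurface.hypersurface f) 3 3 x y)) → ((∀ x, h (pull (diagonalAut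 f ha) 3 x) = pull (diagonalAut f ha) 3 (h x)) ∧ ∀ x y, tr hXF (3 + 3) (cup (SmoothHypersurface.hypersurface f) 3 3 (h x) (h y)) = tr hXF (3 + 3) (cup (SmoothHypersurface.hypersurface f) 3 3 x y)) → g * h * g⁻¹ * h⁻¹ ∈ (hodge exists_isReal_hodgeModel_holds hXF 3).hodgeGroup)) := by
  intro d hd h4d M γ u hu hU A hA t₀ f hf hev hJ hXF ha t hY hΓ'
  haveI hHTF : HodgeTensorFacts.{0, 0} := hodgeTensorFacts_holds
  haveI := finite hY 3
  refine signComm_of_identityComponent_le hNC hd h4d t₀ f hf hev hJ hXF ha ?_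
  obtain ⟨Γ', hle, hfi, hMT⟩ := hΓ'
  rw [HodgeModel.hodgeStructure_eq_hodge exists_isReal_hodgeModel_holds hodgePQ_independent_of_hodgeModel_holds hY (A t) (hA t) 3] at hMT
  exact (glIdentityComponent_subset_of_finiteIndex hle hfi).trans (glZariskiClosure_subset_mumfordTateGroup _ hMT)

open Literature.AlgebraicGeometry.Motives Literature.AlgebraicGeometry.Motives.UniversalHypersurface Literature.AlgebraicGeometry.HodgeTheory Literature.AlgebraicGeometry.HodgeTheory.UniversalHypersurface Literature.AlgebraicGeometry.HodgeTheory.BettiUniverse CategoryTheory.Limits in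
/-- **The same at a HODGE-GENERIC classifying point** (any Hodge-symmetric models `A`): Deligne's lemma `Mon⁰ ⊆ MT` at a Hodge-generic
point is the tree THEOREM `deligne_finiteIndex_monodromy_le_mumfordTateGroup_of_isQuasiProjectiveOver` (quasi-projective total space
`totalM`, smooth irreducible quasi-projective base `baseM`).  This is the entry for the ANALYTIC readings (off a meagre ∕ countable set of
non-Hodge-generic parameters) and the point where the ALGEBRAIC reading consumes Cattani–Deligne–Kaplan.  CONDITIONAL on hN′; CDK-free.
[cite: CarlsonMullerStachPeters2017, Lemma–Definition 15.3.7] [cite: Deligne1972WeilK3, Prop. 7.5] -/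
theorem signComm_of_isHodgeGenericPoint
    (hNC : ∀ (n d : ℕ) (f₁ g₀ g₂ : MvPolynomial (Fin (n + 2)) ℂ) (j k : Fin (n + 2)) (a : Fin (n + 2) → ℂˣ),
      1 ≤ n → 1 ≤ d → Odd n → (∃ (i : Fin (n + 2)) (c : ℂ), g₀ = c • MvPolynomial.X i ^ d) →
      f₁.IsHomogeneous d → g₀.IsHomogeneous d → g₂.IsHomogeneous d → Literature.AlgebraicGeometry.HodgeTheory.IsSymmetricA3Datum f₁ g₀ g₂ j k a →
      ∀ (εa εb : ℝ) (ψ : ℂ → ℂ), Literature.AlgebraicGeometry.HodgeTheory.IsSymmetricA3Bifurcation f₁ g₀ g₂ j a εa εb ψ →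
        ∃ εa' : ℝ, 0 < εa' ∧ εa' ≤ εa ∧ Literature.AlgebraicGeometry.HodgeTheory.SymmetricA3NonCommutation n d f₁ g₀ g₂ ψ εa') :
    ∀ ⦃d : ℕ⦄, Even d → ∀ (h4d : 4 ≤ d), (let M : Set (DegIndex 3 d) := {m | Even (m.1 0 + m.1 1)}; let γ : Fin 5 → ℂˣ := fun i => if (i : ℕ) < 2 then -1 else 1; let u := familyM ℂ 3 d M; let hu : IsSmoothProjectiveFamily u 3 := isSmoothProjectiveFamily_familyM ℂ 3 d M (by decide) (le_trans (by decide) h4d); let hU : IsCohomologicallyLocallyTrivialOn u (Set.univ : Set (ComplexPoints (baseM ℂ 3 d M))) := isCohomologicallyLocallyTrivialOn_familyM 3 d M (by decide) (le_trans (by decide) h4d); ∀ (A : ∀ s : ComplexPoints (baseM ℂ 3 d M), HodgeModel 3 (fiberOver u s)) (hA : ∀ s, (A s).IsHodgeSymmetric) (t₀ : ComplexPoints (baseM ℂ 3 d M)) (f : MvPolynomial (Fin 5) ℂ), f.IsHomogeneous d → (∀ e : Fin 5 →₀ ℕ, ¬ Even (e 0 + e 1) → f.coeff e = 0) → SmoothHypersurface.IsNonsingularForm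 ℂ f → ∀ (hXF : IsSmoothProjective 3 (SmoothHypersurface.hypersurface f)) (ha : γ ∈ diagonalStabilizer f), let t := classifyingPoint ℂ 3 d M t₀ f; (haveI : HodgeTensorFacts.{0, 0} := hodgeTensorFacts_holds; haveI : ∀ s : ComplexPoints (baseM ℂ 3 d M), Module.Finite ℚ (bettiCohomology (fiberOver u s) 3) := fun s => finite (hu.isSmoothProjective s) 3; IsHodgeGenericPoint u 3 hU hu A hA ⟨t, Set.mem_univ _⟩) → (haveI : HodgeTensorFacts.{0, 0} := hodgeTensorFacts_holds; haveI := finite hXF 3; ∀ g h : bettiCohomology (SmoothHypersurface.hypersurface f) 3 ≃ₗ[ℚ] bettiCohomology (SmoothHypersurface.hypersurface f) 3, ((∀ x, g (pull (diagonalAut f ha) 3 x) = pull (diagonalAut f ha) 3 (g x)) ∧ ∀ x y, tr hXF (3 + 3) (cup (SmoothHypersurface.hypersurface f) 3 3 (g x) (g y)) = tr hXF (3 + 3) (cup (SmoothHypersurface.hypersurface f) 3 3 x y)) → ((∀ x, h (pull (diagonalAut f ha) 3 x) = pull (diagonalAut f ha) 3 (h x)) ∧ ∀ x y, tr hXF (3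 + 3) (cup (SmoothHypersurface.hypersurface f) 3 3 (h x) (h y)) = tr hXF (3 + 3) (cup (SmoothHypersurface.hypersurface f) 3 3 x y)) → g * h * g⁻¹ * h⁻¹ ∈ (hodge exists_isReal_hodgeModel_holds hXF 3).hodgeGroup)) := by
  intro d hd h4d M γ u hu hU A hA t₀ f hf hev hJ hXF ha t hsgen
  haveI hHTF : HodgeTensorFacts.{0, 0} := hodgeTensorFacts_holds
  haveI : ∀ s : ComplexPoints (baseM ℂ 3 d M), Module.Finite ℚ (bettiCohomology (fiberOver u s) 3) :=
    fun s => finite (hu.isSmoothProjective s) 3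
  obtain ⟨hirr, -⟩ := Summit.HodgeConjecture.HodgeConjecture.Theorems.SignSymmetricPowersFibreCoreB.stub_signFibreCoreC hd h4d
  have hDel := deligne_finiteIndex_monodromy_le_mumfordTateGroup_of_isQuasiProjectiveOver u 3 3 hu
    (isQuasiProjectiveOver_totalM ℂ 3 d M (lt_of_lt_of_le (by decide) h4d)) (isQuasiProjectiveOver_baseM 3 d M)
    (smooth_baseM_hom ℂ 3 d M) hirr hU A hA ⟨t, Set.mem_univ _⟩ hsgen
  exact signComm_of_finiteIndex_le_mumfordTate hNC hd h4d A hA t₀ f hf hev hJ hXF ha hDel.1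

/-! ### §2 From the models `X_f` to every threefold cut out by `f`, and the Hodge conjecture on all powers -/

open Literature.AlgebraicGeometry.Motives Literature.AlgebraicGeometry.Motives.UniversalHypersurface Literature.AlgebraicGeometry.HodgeTheory Literature.AlgebraicGeometry.HodgeTheory.UniversalHypersurface Literature.AlgebraicGeometry.HodgeTheory.BettiUniverse CategoryTheory.Limits in
/-- **HC on all powers of every threefold cut out by `f`, from `(Γ^Zar)⁰ ⊆ MT` at the classifying point of `f`** (per-point form of
the rung leaf `SignThreefoldPowersHodge`; CDK-free): the deck clauses of `X_f` (`exists_signDeckModel_clauses_one_two`, deck Hodge numbers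
`signDeckHodge_of_genusBound stub_genusBoundThreefold`) and §1 give the route's `Deck ∧ Comm` package on the model, transported to any `X`
with `IsHypersurfaceCutOutBy 4 f X` along `e : X ≅ X_f` exactly as in `stub_modelTransfer` (`pull_conj_sq_eq_one_of_iso`,
`tr_cup_pull_conj_of_iso`, `finrank_eigenspace_inf_piece_eq_of_iso`, `comm_of_iso`); then K2-B
`SignSymmetricPowersClose.powersHodgeOfSignCommutators` (item 19717, closed).  CONDITIONAL on hN′ (`hNC`). [cite: VoisinHodgeII2003, §6.1.3 Cor. 6.12]
[cite: Arapura2012, §17.3 (17.3.1)] [cite: CarlsonMullerStachPeters2017, Lemma–Definition 15.3.7] -/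
theorem hodgeConjectureFor_signPowers_of_identityComponent_le
    (hNC : ∀ (n d : ℕ) (f₁ g₀ g₂ : MvPolynomial (Fin (n + 2)) ℂ) (j k : Fin (n + 2)) (a : Fin (n + 2) → ℂˣ),
      1 ≤ n → 1 ≤ d → Odd n → (∃ (i : Fin (n + 2)) (c : ℂ), g₀ = c • MvPolynomial.X i ^ d) →
      f₁.IsHomogeneous d → g₀.IsHomogeneous d → g₂.IsHomogeneous d → Literature.AlgebraicGeometry.HodgeTheory.IsSymmetricA3Datum f₁ g₀ g₂ j k a →
      ∀ (εa εb : ℝ) (ψ : ℂ → ℂ), Literature.AlgebraicGeometry.HodgeTheory.IsSymmetricA3Bifurcation f₁ g₀ g₂ j a εa εb ψ →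
        ∃ εa' : ℝ, 0 < εa' ∧ εa' ≤ εa ∧ Literature.AlgebraicGeometry.HodgeTheory.SymmetricA3NonCommutation n d f₁ g₀ g₂ ψ εa') :
    ∀ ⦃d : ℕ⦄, Even d → ∀ (h4d : 4 ≤ d), (let M : Set (DegIndex 3 d) := {m | Even (m.1 0 + m.1 1)}; let u := familyM ℂ 3 d M; let hu : IsSmoothProjectiveFamily u 3 := isSmoothProjectiveFamily_familyM ℂ 3 d M (by decide) (le_trans (by decide) h4d); let hU : IsCohomologicallyLocallyTrivialOn u (Set.univ : Set (ComplexPoints (baseM ℂ 3 d M))) := isCohomologicallyLocallyTrivialOn_familyM 3 d M (by decide) (le_trans (by decide) h4d); ∀ (t₀ : ComplexPoints (baseM ℂ 3 d M)) (f : MvPolynomial (Fin 5) ℂ), f.IsHomogeneous d → (∀ e : Fin 5 →₀ ℕ, ¬ Even (e 0 + e 1) → f.coeff e = 0) → SmoothHypersurface.IsNonsingularForm ℂ f → let t := classifyingPoint ℂ 3 d M t₀ f; let hY : IsSmoothProjective 3 (fiberOver u t) := hu.isSmoothProjective t; (haveI : HodgeTensorFacts.{0, 0} := hodgeTensorFacts_holds;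 haveI := finite hY 3; glIdentityComponent (ratMonodromyGroup u 3 hU ⟨t, Set.mem_univ _⟩) ⊆ ((hodge exists_isReal_hodgeModel_holds hY 3).mumfordTateGroup : Set (bettiCohomology (fiberOver u t) 3 ≃ₗ[ℚ] bettiCohomology (fiberOver u t) 3))) → ∀ ⦃X : SchemeOver ℂ⦄, IsSmoothProjective 3 X → IsHypersurfaceCutOutBy 4 f X → ∀ ⦃k : ℕ⦄ ⦃Y : SchemeOver ℂ⦄, (∃ π : Fin (k + 1) → (Y ⟶ X), Nonempty (IsLimit (Fan.mk Y π))) → HodgeConjectureFor (3 * (k + 1)) Y) := by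
  intro d hd h4d M u hu hU t₀ f hf hev hJ t hY hΓ X hX hcut k Y hYfan
  haveI hHTF : HodgeTensorFacts.{0, 0} := hodgeTensorFacts_holds
  obtain ⟨e⟩ := hcut.nonempty_iso_hypersurface
  have hXF : IsSmoothProjective 3 (SmoothHypersurface.hypersurface f) := hX.of_iso e
  -- Deck clauses on the model `X_f`
  obtain ⟨ha, h1, h2⟩ := exists_signDeckModel_clauses_one_two f hev hXF
  have h3 := signDeckHodge_of_genusBound
    Summit.HodgeConjecture.HodgeConjecture.Theorems.SmoothHypersurfaceGeometricGenus.stub_genusBoundThreefold hd h4d f hf hev hJ hXF ha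
  -- Comm on the model: §1
  have hComm := signComm_of_identityComponent_le hNC hd h4d t₀ f hf hev hJ hXF ha hΓ
  -- model transfer along `e : X ≅ X_f`, then K2-B
  refine Summit.HodgeConjecture.HodgeConjecture.Theorems.SignSymmetricPowersClose.powersHodgeOfSignCommutators hd h4d hX ⟨f, hf, hev, hcut⟩
    ⟨e.hom ≫ diagonalAut f ha ≫ e.inv, ⟨pull_conj_sq_eq_one_of_iso e h1, tr_cup_pull_conj_of_iso hX hXF e h2, fun j q hj hq => ?_⟩, ?_⟩ hYfan
  · rw [finrank_eigenspace_inf_piece_eq_of_iso exists_isReal_hodgeModel_holds hodgePQ_independent_of_hodgeModel_holds hX hXF e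
      (diagonalAut f ha) 3]
    exact h3 j q hj hq
  · exact comm_of_iso exists_isReal_hodgeModel_holds hodgePQ_independent_of_hodgeModel_holds hX hXF e (diagonalAut f ha) 3 hComm

open Literature.AlgebraicGeometry.Motives Literature.AlgebraicGeometry.Motives.UniversalHypersurface Literature.AlgebraicGeometry.HodgeTheory Literature.AlgebraicGeometry.HodgeTheory.UniversalHypersurface Literature.AlgebraicGeometry.HodgeTheory.BettiUniverse CategoryTheory.Limits in
/-- **The same from a finite-index subgroup of the monodromy group inside `MT`** (any Hodge-symmetric models `A`) — the shape delivered
on a transversal pencil by Zariski's theorem + base change of monodromy.  CONDITIONAL on hN′; CDK-free.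
[cite: CarlsonMullerStachPeters2017, Lemma–Definition 15.3.7 and Theorem 15.2.9] [cite: Arapura2012, §17.3 (17.3.1)] -/
theorem hodgeConjectureFor_signPowers_of_finiteIndex_le_mumfordTate
    (hNC : ∀ (n d : ℕ) (f₁ g₀ g₂ : MvPolynomial (Fin (n + 2)) ℂ) (j k : Fin (n + 2)) (a : Fin (n + 2) → ℂˣ),
      1 ≤ n → 1 ≤ d → Odd n → (∃ (i : Fin (n + 2)) (c : ℂ), g₀ = c • MvPolynomial.X i ^ d) →
      f₁.IsHomogeneous d → g₀.IsHomogeneous d → g₂.IsHomogeneous d → Literature.AlgebraicGeometry.HodgeTheory.IsSymmetricA3Datum f₁ g₀ g₂ j k a →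
      ∀ (εa εb : ℝ) (ψ : ℂ → ℂ), Literature.AlgebraicGeometry.HodgeTheory.IsSymmetricA3Bifurcation f₁ g₀ g₂ j a εa εb ψ →
        ∃ εa' : ℝ, 0 < εa' ∧ εa' ≤ εa ∧ Literature.AlgebraicGeometry.HodgeTheory.SymmetricA3NonCommutation n d f₁ g₀ g₂ ψ εa') :
    ∀ ⦃d : ℕ⦄, Even d → ∀ (h4d : 4 ≤ d), (let M : Set (DegIndex 3 d) := {m | Even (m.1 0 + m.1 1)}; let u := familyM ℂ 3 d M; let hu : IsSmoothProjectiveFamily u 3 := isSmoothProjectiveFamily_familyM ℂ 3 d M (by decide) (le_trans (by decide) h4d); let hU : IsCohomologicallyLocallyTrivialOn u (Set.univ : Set (ComplexPoints (baseM ℂ 3 d M))) := isCohomologicallyLocallyTrivialOn_familyM 3 d M (by decide) (le_trans (by decide) h4d); ∀ (A : ∀ s : ComplexPoints (baseM ℂ 3 d M), HodgeModel 3 (fiberOver u s)) (hA : ∀ s, (A s).IsHodgeSymmetric) (t₀ : ComplexPoints (baseM ℂ 3 d M)) (f : MvPolynomial (Fin 5) ℂ), f.IsHomogeneous d → (∀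 e : Fin 5 →₀ ℕ, ¬ Even (e 0 + e 1) → f.coeff e = 0) → SmoothHypersurface.IsNonsingularForm ℂ f → let t := classifyingPoint ℂ 3 d M t₀ f; let hY : IsSmoothProjective 3 (fiberOver u t) := hu.isSmoothProjective t; (haveI : HodgeTensorFacts.{0, 0} := hodgeTensorFacts_holds; haveI := finite hY 3; ∃ Γ' : Subgroup (bettiCohomology (fiberOver u t) 3 ≃ₗ[ℚ] bettiCohomology (fiberOver u t) 3), Γ' ≤ ratMonodromyGroup u 3 hU ⟨t, Set.mem_univ _⟩ ∧ (Γ'.subgroupOf (ratMonodromyGroup u 3 hU ⟨t, Set.mem_univ _⟩)).FiniteIndex ∧ Γ' ≤ ((A t).hodgeStructure hY (hA t) 3).mumfordTateGroup) → ∀ ⦃X : SchemeOver ℂ⦄, IsSmoothProjective 3 X → IsHypersurfaceCutOutBy 4 f X → ∀ ⦃k : ℕ⦄ ⦃Y : SchemeOver ℂ⦄, (∃ π : Fin (k + 1) → (Y ⟶ X), Nonempty (IsLimit (Fan.mk Y π))) → HodgeConjectureFor (3 * (k + 1)) Y) := by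
  intro d hd h4d M u hu hU A hA t₀ f hf hev hJ t hY hΓ'
  haveI hHTF : HodgeTensorFacts.{0, 0} := hodgeTensorFacts_holds
  haveI := finite hY 3
  refine hodgeConjectureFor_signPowers_of_identityComponent_le hNC hd h4d t₀ f hf hev hJ ?_
  obtain ⟨Γ', hle, hfi, hMT⟩ := hΓ'
  rw [HodgeModel.hodgeStructure_eq_hodge exists_isReal_hodgeModel_holds hodgePQ_independent_of_hodgeModel_holds hY (A t) (hA t) 3] at hMT
  exact (glIdentityComponent_subset_of_finiteIndex hle hfi).trans (glZariskiClosure_subset_mumfordTateGroup _ hMT)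

open Literature.AlgebraicGeometry.Motives Literature.AlgebraicGeometry.Motives.UniversalHypersurface Literature.AlgebraicGeometry.HodgeTheory Literature.AlgebraicGeometry.HodgeTheory.UniversalHypersurface Literature.AlgebraicGeometry.HodgeTheory.BettiUniverse CategoryTheory.Limits in
/-- **The same at a HODGE-GENERIC classifying point** (any Hodge-symmetric models `A`; Deligne's lemma is the tree theorem
`deligne_finiteIndex_monodromy_le_mumfordTateGroup_of_isQuasiProjectiveOver`) — the per-point statement both CDK-free readings of route B
end in: HC holds on ALL self fibre powers of EVERY smooth projective threefold cut out in `ℙ⁴` by an ι-even form whose classifying point in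
the monomial-supported ι-even family is Hodge generic.  CONDITIONAL on hN′; CDK-free.  (The crux AS TYPED quantifies over VERY GENERAL forms;
that Hodge-generic points are very general is Cattani–Deligne–Kaplan — not used here.) [cite: CarlsonMullerStachPeters2017, Lemma–Definition 15.3.7]
[cite: Deligne1972WeilK3, Prop. 7.5] [cite: Arapura2012, §17.3 (17.3.1)] -/
theorem hodgeConjectureFor_signPowers_of_isHodgeGenericPoint
    (hNC : ∀ (n d : ℕ) (f₁ g₀ g₂ : MvPolynomial (Fin (n + 2)) ℂ) (j k : Fin (n + 2)) (a : Fin (n + 2) → ℂˣ),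
      1 ≤ n → 1 ≤ d → Odd n → (∃ (i : Fin (n + 2)) (c : ℂ), g₀ = c • MvPolynomial.X i ^ d) →
      f₁.IsHomogeneous d → g₀.IsHomogeneous d → g₂.IsHomogeneous d → Literature.AlgebraicGeometry.HodgeTheory.IsSymmetricA3Datum f₁ g₀ g₂ j k a →
      ∀ (εa εb : ℝ) (ψ : ℂ → ℂ), Literature.AlgebraicGeometry.HodgeTheory.IsSymmetricA3Bifurcation f₁ g₀ g₂ j a εa εb ψ →
        ∃ εa' : ℝ, 0 < εa' ∧ εa' ≤ εa ∧ Literature.AlgebraicGeometry.HodgeTheory.SymmetricA3NonCommutation n d f₁ g₀ g₂ ψ εa') :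
    ∀ ⦃d : ℕ⦄, Even d → ∀ (h4d : 4 ≤ d), (let M : Set (DegIndex 3 d) := {m | Even (m.1 0 + m.1 1)}; let u := familyM ℂ 3 d M; let hu : IsSmoothProjectiveFamily u 3 := isSmoothProjectiveFamily_familyM ℂ 3 d M (by decide) (le_trans (by decide) h4d); let hU : IsCohomologicallyLocallyTrivialOn u (Set.univ : Set (ComplexPoints (baseM ℂ 3 d M))) := isCohomologicallyLocallyTrivialOn_familyM 3 d M (by decide) (le_trans (by decide) h4d); ∀ (A : ∀ s : ComplexPoints (baseM ℂ 3 d M), HodgeModel 3 (fiberOver u s)) (hA : ∀ s, (A s).IsHodgeSymmetric) (t₀ : ComplexPoints (baseM ℂ 3 d M)) (f : MvPolynomial (Fin 5) ℂ), f.IsHomogeneous d → (∀ e : Fin 5 →₀ ℕ, ¬ Even (e 0 + e 1) → f.coeff e = 0) → SmoothHypersurface.IsNonsingularForm ℂ f → let t := classifyingPoint ℂ 3 d M t₀ f; (haveI : HodgeTensorFacts.{0, 0} := hodgeTensorFacts_holds; haveI : ∀ s : ComplexPoints (baseM ℂ 3 d M), Module.Finite ℚ (bettiCohomology (fiberOver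 u s) 3) := fun s => finite (hu.isSmoothProjective s) 3; IsHodgeGenericPoint u 3 hU hu A hA ⟨t, Set.mem_univ _⟩) → ∀ ⦃X : SchemeOver ℂ⦄, IsSmoothProjective 3 X → IsHypersurfaceCutOutBy 4 f X → ∀ ⦃k : ℕ⦄ ⦃Y : SchemeOver ℂ⦄, (∃ π : Fin (k + 1) → (Y ⟶ X), Nonempty (IsLimit (Fan.mk Y π))) → HodgeConjectureFor (3 * (k + 1)) Y) := by
  intro d hd h4d M u hu hU A hA t₀ f hf hev hJ t hsgen
  haveI hHTF : HodgeTensorFacts.{0, 0} := hodgeTensorFacts_holds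
  haveI : ∀ s : ComplexPoints (baseM ℂ 3 d M), Module.Finite ℚ (bettiCohomology (fiberOver u s) 3) :=
    fun s => finite (hu.isSmoothProjective s) 3
  obtain ⟨hirr, -⟩ := Summit.HodgeConjecture.HodgeConjecture.Theorems.SignSymmetricPowersFibreCoreB.stub_signFibreCoreC hd h4d
  have hDel := deligne_finiteIndex_monodromy_le_mumfordTateGroup_of_isQuasiProjectiveOver u 3 3 hu
    (isQuasiProjectiveOver_totalM ℂ 3 d M (lt_of_lt_of_le (by decide) h4d)) (isQuasiProjectiveOver_baseM 3 d M)
    (smooth_baseM_hom ℂ 3 d M) hirr hU A hA ⟨t, Set.mem_univ _⟩ hsgen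
  exact hodgeConjectureFor_signPowers_of_finiteIndex_le_mumfordTate hNC hd h4d A hA t₀ f hf hev hJ hDel.1

end Summit.HodgeConjecture.HodgeConjecture.Theorems.SignSymmetricPowersFiniteIndexMonodromySignCommutators

end
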